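import Summits.MatrixMultiplication.OmegaCensus.SmallFormats.MatMul22nRankGF5XCapParity
import HarnessLib

/-!
# ω-census family (a): the abstract LP value of the X-cap system over `𝔽₅` and tightness of the row-plane rows

Cell `pub-omega` (unit `pub-omega-tensor-g11`), topic `Summits/MatrixMultiplication/OmegaCensus` (sub-folder `SmallFormats`).
Framing (verbatim): lottery ticket; floor = certified bounds/negative ranges. HONEST FRAMING: structure facts about the census
INSTRUMENT, not a rank bound, not progress on `ω`. Complements `MatMul22nRankGF5XCapParity`: for every nonnegative integer point `x`
of the 350 cap / row-plane rows of `xcapSys5s s`, the weighted-row identity gives the LP VALUE bound `∑ x ≤ 28 s` outright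
(`total_le_of_rows350` — the abstract form of the counting bound `27·R ≥ 84·n`, i.e. `M₅(s) ≤ s(q²+3)`), and at the LP value the six
row-plane rows are tight as well (`rowPlane_tight_of_total_ge`) and the total is exactly `28 s` (`total_eq_of_total_ge`). Used by the
pattern case analysis of the successor blueprint (`pub-omega-tensor-g11/METHOD-PARITY-g11.md`): row sums of `μ` equal `2s`, so the
parity vectors `α, β` of the parity lemma have even weight.
-/

namespace Summit.MatrixMultiplication.OmegaCensus.SmallFormats

open Finset

variable {s : ℕ} {x : ℕ → ℕ}

/-- The weighted row total: `∑_r ywt5_r · row_r(x) = 6·∑_{j<156} x_j + 156·x_156`. -/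
theorem weighted_rows_eq (s : ℕ) (x : ℕ → ℕ) :
    ∑ r ∈ range 498, (ywt5 r : ℤ) * rowVal5 s x r = 6 * ∑ j ∈ range 156, (x j : ℤ) + 156 * (x 156 : ℤ) := by
  rw [sum_mul_rowVal5]
  rw [show ∑ j ∈ range 157, xcapSys5.yA ywt5 j * (x j : ℤ) = ∑ j ∈ range 156, xcapSys5.yA ywt5 j * (x j : ℤ)
      + xcapSys5.yA ywt5 156 * (x 156 : ℤ) from by simpa using (sum_range_succ (fun j => xcapSys5.yA ywt5 j * (x j : ℤ)) 156)]
  have h1 : ∀ j ∈ range 156, xcapSys5.yA ywt5 j * (x j : ℤ) = 6 * (x j : ℤ) := by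
    intro j hj
    have := yA_ywt5 ⟨j, by simp at hj; omega⟩
    simp only [show j < 156 from by simpa using hj, if_true] at this
    rw [this]
  have h2 : xcapSys5.yA ywt5 156 = 156 := by
    have := yA_ywt5 ⟨156, by norm_num⟩; simpa using this
  rw [sum_congr rfl h1, h2, ← mul_sum]

/-- The weighted right-hand sides: `∑_r ywt5_r · rhs_r = 168·s`. -/
theorem weighted_rhs_eq (s : ℕ) : ∑ r ∈ range 498, (ywt5 r : ℤ) * rhs5s s r = 168 * (s : ℤ) := by
  have e : ∀ r ∈ range 498, (ywt5 r : ℤ) * rhs5s s r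
      = (s : ℤ) * ((ywt5 r : ℤ) * (if r < 344 then 1 else if r < 350 then 2 else 0)) := by
    intro r _
    unfold rhs5s; split_ifs <;> ring
  rw [sum_congr rfl e, ← mul_sum, sum_ywt5_base]; ring

/-- The weighted rows are bounded by the weighted right-hand sides. -/
theorem weighted_rows_le (h350 : ∀ r < 350, rowVal5 s x r ≤ rhs5s s r) :
    ∑ r ∈ range 498, (ywt5 r : ℤ) * rowVal5 s x r ≤ 168 * (s : ℤ) := by
  rw [← weighted_rhs_eq s]
  refine sum_le_sum fun r _ => ?_
  by_cases h : r < 350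
  · exact mul_le_mul_of_nonneg_left (h350 r h) (by exact_mod_cast Nat.zero_le _)
  · have : (ywt5 r : ℤ) = 0 := by simp [ywt5, show ¬ r < 144 by omega, show ¬ (344 ≤ r ∧ r < 350) by omega]
    rw [this]; simp

/-- **The abstract LP value** (`M₅(s) ≤ s(q²+3) = 28 s`): every nonnegative integer point of the 350 cap / row-plane rows of the
slack-`s` system has total at most `28 s`. -/
theorem total_le_of_rows350 (h350 : ∀ r < 350, rowVal5 s x r ≤ rhs5s s r) : ∑ j ∈ range 157, (x j : ℤ) ≤ 28 * (s : ℤ) := by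
  have hL := weighted_rows_eq s x
  have hLQ := weighted_rows_le h350
  have hsplit : ∑ j ∈ range 157, (x j : ℤ) = ∑ j ∈ range 156, (x j : ℤ) + (x 156 : ℤ) := by
    simpa using (sum_range_succ (fun j => (x j : ℤ)) 156)
  have hz : (0 : ℤ) ≤ (x 156 : ℤ) := by exact_mod_cast Nat.zero_le _
  rw [hsplit]; linarith

/-- At the LP value the total is exactly `28 s`. -/
theorem total_eq_of_total_ge (h350 : ∀ r < 350, rowVal5 s x r ≤ rhs5s s r) (htot : 28 * (s : ℤ) ≤ ∑ j ∈ range 157, (x j : ℤ)) :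
    ∑ j ∈ range 157, (x j : ℤ) = 28 * (s : ℤ) :=
  le_antisymm (total_le_of_rows350 h350) htot

/-- **Row planes are tight at the LP value**: each of the six row-plane rows sums to exactly `2 s`. -/
theorem rowPlane_tight_of_total_ge (h350 : ∀ r < 350, rowVal5 s x r ≤ rhs5s s r)
    (htot : 28 * (s : ℤ) ≤ ∑ j ∈ range 157, (x j : ℤ)) : ∀ r, 344 ≤ r → r < 350 → rowVal5 s x r = 2 * (s : ℤ) := by
  have hz := (tight5_of_total_ge h350 htot).1
  have hL := weighted_rows_eq s x
  have hQ := weighted_rhs_eq s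
  have hsplit : ∑ j ∈ range 157, (x j : ℤ) = ∑ j ∈ range 156, (x j : ℤ) + (x 156 : ℤ) := by
    simpa using (sum_range_succ (fun j => (x j : ℤ)) 156)
  have hzero : ∑ r ∈ range 498, (ywt5 r : ℤ) * (rhs5s s r - rowVal5 s x r) = 0 := by
    have e : ∑ r ∈ range 498, (ywt5 r : ℤ) * (rhs5s s r - rowVal5 s x r)
        = ∑ r ∈ range 498, (ywt5 r : ℤ) * rhs5s s r - ∑ r ∈ range 498, (ywt5 r : ℤ) * rowVal5 s x r := by
      rw [← sum_sub_distrib]; exact sum_congr rfl fun r _ => by ring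
    rw [e, hQ, hL, hz]; push_cast
    rw [hsplit, hz] at htot; push_cast at htot
    have hLQ := weighted_rows_le h350
    rw [hL, hz] at hLQ; push_cast at hLQ
    linarith
  have hnn : ∀ r ∈ range 498, 0 ≤ (ywt5 r : ℤ) * (rhs5s s r - rowVal5 s x r) := fun r _ => by
    by_cases h : r < 350
    · exact mul_nonneg (by exact_mod_cast Nat.zero_le _) (sub_nonneg.2 (h350 r h))
    · have : (ywt5 r : ℤ) = 0 := by simp [ywt5, show ¬ r < 144 by omega, show ¬ (344 ≤ r ∧ r < 350) by omega]
      rw [this]; simp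
  have hterm := (sum_eq_zero_iff_of_nonneg hnn).1 hzero
  intro r h344 h350'
  have h := hterm r (mem_range.2 (by omega))
  have hw : (ywt5 r : ℤ) = 2 := by simp [ywt5, show ¬ r < 144 by omega, h344, h350']
  have hrhs : rhs5s s r = 2 * (s : ℤ) := by simp [rhs5s, show ¬ r < 344 by omega, h350']
  rw [hw, hrhs] at h
  have : 2 * (2 * (s : ℤ) - rowVal5 s x r) = 0 := h
  linarith

end Summit.MatrixMultiplication.OmegaCensus.SmallFormats
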